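import Literature.IUT.HodgeArakelov.MonoThetaCyclotomes
import Literature.IUT.HodgeTheaters.LabelsPlusMinus
import Mathlib.GroupTheory.SemidirectProduct

/-!
# [IUTchII] §1, Remark 1.1.1: the mono-theta-theoretic cyclotomic rigidity isomorphism in detail

Mochizuki, *Inter-universal Teichmüller theory II*, §1, Remark 1.1.1 (i)–(v), kurims manuscript
(Dec. 2020) pp. 21–25 [claim: Mochizuki2012, status: disputed] (IUTchII §1 Rmk 1.1.1, kurims pp.21-25). Record-only typing under
the claim key `Mochizuki2012` (D-0012, disputed): definitions and `Prop`-valued statements only.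

Remark 1.1.1 reviews how the cyclotomic rigidity isomorphism of Definition 1.1 (ii) is built from a
mono-theta environment `M` ([EtTh] Cor. 2.19 (i)) and records its `𝔽_l^{⋊±}`-symmetry:
* (i) `Π_X(M)` determines the open subgroups `Π_Y ⊆ Π_X̲ ⊆ Π_C (⊇ Π_X ⊇ Π_X̲̲)` of the core group
  `Π_C(M)` (coverings `Y → X̲ → C` of the discussion preceding [EtTh] Def. 2.7), with compatible
  surjections to `G(M)`, kernels `Δ_…`, and the `Θ`/`ell` subquotients; e.g. the quotient
  `Π_M ↠ Π_Y(M) ↠ Π^ell_Y(M)` (`≅ Ẑ(1) ⋊ G_k`) — typed as `CoreTower`;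
* (ii) `Π_M|_H` for closed `H ⊆ Π_Y(M)` (inverse image — DEFINED, `MonoThetaEnv.restrictTo`), and the
  quotient `Π_M|_{Π^Θ_Y}` by the theta section over `Ker(Π_Y ↠ Π^Θ_Y)` — typed as `ThetaQuotientData`,
  with the subquotient `Π_M|_{(l·Δ_Θ)}` DEFINED (`envAtTheta`);
* (iii) inside `Π_M|_{(l·Δ_Θ)}`: the subgroup `Π_μ(M)`, the theta section `s^Θ|_{(l·Δ_Θ)}`, the bilinear
  commutator map `[-,-] : (Δ_X/Δ_Y) × Δ^ell_Y → Π_M|_{(l·Δ_Θ)}` whose image is `s^alg|_{(l·Δ_Θ)}`, both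
  sections mapping isomorphically onto `(l·Δ_Θ)(M)`, and "the cyclotomic rigidity isomorphism is
  reconstructed by forming the difference of the two sections" — `TwoSections`,
  `rigidity_is_difference`;
* (iv) these constructions are stabilized by the natural conjugation action of `Π_C(M)` (which on
  `Π_M|_{(l·Δ_Θ)}` factors through `G(M)` and is the cyclotomic-character action), hence by
  `Δ_C(M) ↠ Δ_C(M)/Δ_X(M) ≅ 𝔽_l^{⋊±}`; the commutator map is `Π_C(M)`-equivariant — `FlSymmetry`;
* `IUTchII:Rmk1.1.1(v)` is expository (mono- vs bi-theta environments; "denominators `1/l`" vanish in the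
  commutator) and carries no separately typeable claim: recorded here in prose only (C1 'noted').

Node map for the parent file `MonoThetaCyclotomes` (filed before the node-id convention): `IUTchII:Def1.1(i)` ↦
`Reconstruction` (+ `Def11_i_algorithms`), `IUTchII:Def1.1(ii)` ↦ `CyclotomicRigidity` (+
`Def11_ii_cyclotomicRigidity`); §1 preamble p. 20 ↦ `ThetaSetting`, [EtTh] Def. 2.13 (ii) ↦ `MonoThetaEnv`.

`𝔽_l^{⋊±} = 𝔽_l ⋊ {±1}` ([IUTchI] Def. 6.1) is the tree's `Literature.IUT.HodgeTheaters.FlPM` (L5-t4,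
imported). Encoding conventions as in `MonoThetaCyclotomes`
(text-extraction caveat on underlines applies: `X̲` single, `X̲̲` double underline).
-/

namespace Literature.IUT.HodgeArakelov

universe u

open Subgroup

/-! `𝔽_l^{⋊±} = 𝔽_l ⋊ {±1}` ([IUTchI] Def. 6.1) is the tree's `Literature.IUT.HodgeTheaters.FlPM l`
(abc-iut-L5-t4, `LabelsPlusMinus.lean`, built) — imported, not re-declared (C9/G3). -/

variable {S : ThetaSetting.{u}} {M : MonoThetaEnv S}

attribute [instance] Reconstruction.inclY_normal

/-- `(l·ℤ)(M) = Π_X(M)/Π_Y(M)` is a group (quotient by the normal open subgroup `Π_Y(M)`).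
[claim: Mochizuki2012, status: disputed] (IUTchII §1 Def 1.1 (i), kurims p.21) -/
instance Reconstruction.instGroupLZ (R : Reconstruction M) : Group R.lZ := by
  dsimp only [Reconstruction.lZ]; infer_instance

/-! ## Remark 1.1.1 (ii): restriction of `Π_M` to closed subgroups of `Π_Y(M)` -/

/-- **IUTchII:Rmk1.1.1(ii)** (p. 22): "any closed subgroup `H ⊆ Π_Y(M)` determines, by forming the inverse image
via the quotient `Π_M ↠ Π_Y(M)`, a closed subgroup `Π_M|_H ⊆ Π_M`." (Defined for every subgroup.)
[claim: Mochizuki2012, status: disputed] (IUTchII §1 Rmk 1.1.1 (ii), kurims p.22) -/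
abbrev Reconstruction.restrictTo (R : Reconstruction M) (H : Subgroup R.PiY) : Subgroup M.Pi :=
  H.comap R.projY

/-- **IUTchII:Rmk1.1.1(ii)** (p. 22), the theta quotient: "by forming the quotient of `Π_M` by the restriction
of the theta section portion of `M` [cf. [EtTh], Def. 2.13, (ii), (c)] to the subgroup
`Ker(Π_Y(M) ↠ Π^Θ_Y(M)) ⊆ Π_Y(M)`, it makes sense to speak of the quotient
`(Π_M ↠) Π_M|_{Π^Θ_Y(M)} (↠ Π^Θ_Y(M))` determined by the quotient `Π_Y(M) ↠ Π^Θ_Y(M)` … In particular,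
it makes sense to speak of the subquotient of `Π_M` determined by any closed subgroup — such as
`(l·Δ_Θ)(M) ⊆ Π^Θ_Y(M)` — of `Π^Θ_Y(M)`." DATA: the kernel `Ker(Π_Y ↠ Π^Θ_Y)` (normal), the restricted
theta section `s^Θ|_{Ker}` as a normal subgroup of `Π_M` mapping isomorphically onto that kernel, and the
compatibility `(l·Δ_Θ)(M) ⊆ Π^Θ_Y(M)` (the interior cyclotome of `R` is a subgroup of the theta quotient).
[claim: Mochizuki2012, status: disputed] (IUTchII §1 Rmk 1.1.1 (ii), kurims p.22) -/
structure ThetaQuotientData (R : Reconstruction M) : Type u where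
  /-- `Ker(Π_Y(M) ↠ Π^Θ_Y(M))` -/
  kerTheta : Subgroup R.PiY
  kerTheta_normal : kerTheta.Normal
  /-- the restriction `s^Θ|_{Ker}` of the theta section portion, a subgroup of `Π_M` -/
  thetaSection : Subgroup M.Pi
  thetaSection_normal : thetaSection.Normal
  /-- `s^Θ|_{Ker}` maps isomorphically onto `Ker(Π_Y ↠ Π^Θ_Y)` under `Π_M ↠ Π_Y(M)` -/
  thetaSection_bijOn : Set.BijOn R.projY thetaSection kerTheta
  /-- "`(l·Δ_Θ)(M) ⊆ Π^Θ_Y(M)`": the interior cyclotome is the subquotient `top / Ker` -/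
  intCyc_bot_eq : R.intCyc.bot = kerTheta

namespace ThetaQuotientData

variable {R : Reconstruction M} (T : ThetaQuotientData R)

/-- The restricted theta section lies over `(l·Δ_Θ)(M)`'s ambient subgroup (PROVED from the data).
[claim: Mochizuki2012, status: disputed] (IUTchII §1 Rmk 1.1.1 (ii), kurims p.22) -/
lemma thetaSection_le : T.thetaSection ≤ R.intCyc.top.comap R.projY := by
  intro x hx
  have h1 : R.projY x ∈ T.kerTheta := T.thetaSection_bijOn.mapsTo hx
  rw [← T.intCyc_bot_eq] at h1
  exact R.intCyc.le h1

/-- **IUTchII:Rmk1.1.1(ii)**: the subquotient `Π_M|_{(l·Δ_Θ)(M)}` of `Π_M` — the inverse image of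
`(l·Δ_Θ)(M) ⊆ Π^Θ_Y(M)` in `Π_M|_{Π^Θ_Y} = Π_M / s^Θ|_{Ker}`. [claim: Mochizuki2012, status: disputed] (IUTchII §1 Rmk 1.1.1 (ii), kurims p.22) -/
def envAtTheta : Subquotient M.Pi where
  top := R.intCyc.top.comap R.projY
  bot := T.thetaSection
  le := T.thetaSection_le
  normal := by
    haveI := T.thetaSection_normal
    infer_instance

/-- The natural projection `Π_M|_{(l·Δ_Θ)(M)} ↠ (l·Δ_Θ)(M)` induced by `Π_M ↠ Π_Y(M)`
(Rmk 1.1.1 (iii): "the natural projection `Π_M|_{(l·Δ_Θ)} ↠ (l·Δ_Θ)(M)`").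
[claim: Mochizuki2012, status: disputed] (IUTchII §1 Rmk 1.1.1 (iii), kurims p.22) -/
def proj : T.envAtTheta.carrier →* R.intCyc.carrier :=
  QuotientGroup.map _ _ ((R.projY.restrict _).codRestrict R.intCyc.top (fun x => x.2))
    (by
      intro x hx
      have hb : R.projY (x : M.Pi) ∈ R.intCyc.bot := by
        rw [T.intCyc_bot_eq]; exact T.thetaSection_bijOn.mapsTo hx
      simpa [Subgroup.mem_subgroupOf] using hb)

end ThetaQuotientData

/-! ## Remark 1.1.1 (i): the tower of open subgroups of the core `Π_C(M)` -/

/-- **IUTchII:Rmk1.1.1(i)** (pp. 21–22): "the topological group `Π_X(M)` determines topological groups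
`Π_Y(M)`, `Π_X̲(M)`, and `Π_C(M)` — i.e., corresponding to the coverings `Y^log → X̲^log → C^log` of the
discussion preceding [EtTh], Definition 2.7 — all of which [together with `Π_X(M)`] may be regarded as
open subgroups of `Π_C(M)`: `Π_Y(M) ⊆ Π_X̲(M) ⊆ Π_C(M) (⊇ Π_X(M) ⊇ Π_X̲̲(M))` that are equipped with
compatible surjections to `G(M)`. Write `Δ_Y(M) ⊆ Δ_X̲(M) ⊆ Δ_C(M) (⊇ Δ_X(M) ⊇ Δ_X̲̲(M))` for the
respective kernels. Moreover … subquotients denoted by a superscript `Θ` or `ell` … are completely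
determined by the topological group structure of `Π_C(M)`. For instance, one may reconstruct … the
quotient `Π_M ↠ Π_Y(M) ↠ Π^ell_Y(M)` [isomorphic to `Ẑ(1) ⋊ G_k`]." DATA over a `Reconstruction R`
(whose `Π_X(M)`, isomorphic to `Π^tp_{X̲̲_k}`, is the group `Π_X̲̲(M)` of the display): the core `Π_C`,
five open subgroups with the printed inclusions, an identification of `R.PiX` with the smallest, a
surjection `Π_C ↠ G(M)` extending `R.projG`, and the kernel of `Π_Y(M) ↠ Π^ell_Y(M)` with
`Δ_Y/(Δ_Y ∩ Ker) ≅ Ẑ` abstractly. (Underline decorations restored from [EtTh]; see the module caveat.)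
[claim: Mochizuki2012, status: disputed] (IUTchII §1 Rmk 1.1.1 (i), kurims pp.21-22) -/
structure CoreTower (R : Reconstruction M) : Type (u + 1) where
  /-- the core group `Π_C(M)` -/
  PiC : TopGroup.{u}
  /-- `Π_Y ⊆ Π_X̲ ⊆ Π_C ⊇ Π_X ⊇ Π_X̲̲` as open subgroups of `Π_C` -/
  Y : Subgroup PiC
  Xbar : Subgroup PiC
  X : Subgroup PiC
  Xbarbar : Subgroup PiC
  Y_le_Xbar : Y ≤ Xbar
  Xbarbar_le_X : Xbarbar ≤ X
  Y_le_Xbarbar : Y ≤ Xbarbar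
  isOpen_Y : IsOpen (Y : Set PiC)
  isOpen_Xbar : IsOpen (Xbar : Set PiC)
  isOpen_X : IsOpen (X : Set PiC)
  isOpen_Xbarbar : IsOpen (Xbarbar : Set PiC)
  /-- `R.PiX = Π_X̲̲(M)` identified with the open subgroup `Xbarbar` -/
  isoXbarbar : R.PiX ≃ₜ* Xbarbar
  /-- under this identification `Π_Y(M) ⊆ Π_X(M)` is `Y` -/
  isoXbarbar_Y : (R.inclY.range).map
      ((Xbarbar.subtype).comp isoXbarbar.toMulEquiv.toMonoidHom) = Y
  /-- the surjection `Π_C ↠ G(M)` compatible with `R.projG` -/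
  projG : PiC →* R.G
  projG_surjective : Function.Surjective projG
  projG_compat : ∀ x : R.PiX, projG (isoXbarbar x : PiC) = R.projG x
  /-- `Ker(Π_Y(M) ↠ Π^ell_Y(M))`, a normal subgroup of `Π_Y(M)` -/
  kerEll : Subgroup R.PiY
  kerEll_normal : kerEll.Normal
  /-- `Π^ell_Y(M) ≅ Ẑ(1) ⋊ G_k`: abstractly, `Δ_Y(M)/(Δ_Y(M) ∩ Ker)` is isomorphic to `Ẑ` -/
  deltaEll_iso : Nonempty
    (R.DeltaY ⧸ (kerEll.subgroupOf R.DeltaY) ≃* Literature.IUT.HodgeTheaters.ZHat)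
  deltaEll_normal : (kerEll.subgroupOf R.DeltaY).Normal

namespace CoreTower

attribute [instance] CoreTower.kerEll_normal CoreTower.deltaEll_normal

variable {R : Reconstruction M} (W : CoreTower R)

/-- `Δ_C(M) := Ker(Π_C(M) ↠ G(M))`. [claim: Mochizuki2012, status: disputed] (IUTchII §1 Rmk 1.1.1 (i), kurims p.21) -/
abbrev DeltaC : Subgroup W.PiC := W.projG.ker

/-- `Δ_X(M) := Π_X(M) ∩ Δ_C(M)` (kernel of the compatible surjection on the open subgroup `Π_X`).
[claim: Mochizuki2012, status: disputed] (IUTchII §1 Rmk 1.1.1 (i), kurims p.21) -/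
abbrev DeltaXplain : Subgroup W.PiC := W.X ⊓ W.DeltaC

/-- `Δ^ell_Y(M) := Δ_Y(M)/(Δ_Y(M) ∩ Ker(Π_Y ↠ Π^ell_Y))`, abstractly `≅ Ẑ` (Rmk 1.1.1 (i), (iii)).
[claim: Mochizuki2012, status: disputed] (IUTchII §1 Rmk 1.1.1 (iii), kurims p.22) -/
abbrev DeltaYell : Type u := R.DeltaY ⧸ (W.kerEll.subgroupOf R.DeltaY)

end CoreTower

/-! ## Remark 1.1.1 (iii): the two sections and the commutator map -/

/-- **IUTchII:Rmk1.1.1(iii)** (pp. 22–23). Inside `Π_M|_{(l·Δ_Θ)(M)}`: "the subgroup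
`Π_μ(M) ↪ Π_M|_{(l·Δ_Θ)(M)}`; the theta section portion determines, by restriction, a subgroup
`s^Θ(M)|_{(l·Δ_Θ)} ⊆ Π_M|_{(l·Δ_Θ)}` that maps isomorphically to `(l·Δ_Θ)(M)` via the natural projection;
… by considering liftings of automorphisms of `Δ_Y(M)` determined by conjugation by elements of
`Δ_X(M)` … and then forming the commutator `γ(β)·β⁻¹` of such liftings with arbitrary `β ∈ Δ_Y(M)`, one
obtains a natural bilinear commutator map `[-,-] : (Δ_X(M)/Δ_Y(M)) × Δ^ell_Y(M) → Π_M|_{(l·Δ_Θ)(M)}`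
— where `(l·ℤ) ≅ Δ_X(M)/Δ_Y(M)` is abstractly isomorphic to `ℤ`, while `Δ^ell_Y(M)` is abstractly
isomorphic to `Ẑ` — whose image determines a subgroup `s^alg(M)|_{(l·Δ_Θ)} ⊆ Π_M|_{(l·Δ_Θ)}` that maps
isomorphically to `(l·Δ_Θ)(M)`." DATA over `T : ThetaQuotientData R` and a core tower `W`.
[claim: Mochizuki2012, status: disputed] (IUTchII §1 Rmk 1.1.1 (iii), kurims pp.22-23) -/
structure TwoSections {R : Reconstruction M} (T : ThetaQuotientData R) (W : CoreTower R) :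
    Type u where
  /-- `s^Θ(M)|_{(l·Δ_Θ)}` -/
  sTheta : Subgroup T.envAtTheta.carrier
  /-- `s^alg(M)|_{(l·Δ_Θ)}` -/
  sAlg : Subgroup T.envAtTheta.carrier
  sTheta_bijOn : Set.BijOn T.proj sTheta Set.univ
  sAlg_bijOn : Set.BijOn T.proj sAlg Set.univ
  /-- `Π_μ(M) ↪ Π_M|_{(l·Δ_Θ)}` is injective (the kernel `s^Θ|_{Ker}` meets `Π_μ(M)` trivially) -/
  extCyc_inf_bot : R.extCyc ⊓ T.thetaSection = ⊥
  /-- the commutator map `[-,-] : (Δ_X/Δ_Y) × Δ^ell_Y → Π_M|_{(l·Δ_Θ)}` -/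
  commutator : R.lZ → W.DeltaYell → T.envAtTheta.carrier
  /-- "bilinear": multiplicative in each variable -/
  commutator_mul_left : ∀ a b y, commutator (a * b) y = commutator a y * commutator b y
  commutator_mul_right : ∀ a y z, commutator a (y * z) = commutator a y * commutator a z
  /-- `(l·ℤ)(M) = Δ_X/Δ_Y ≅ ℤ` abstractly -/
  lZ_iso : Nonempty (R.lZ ≃* Multiplicative ℤ)
  /-- "whose image determines the subgroup `s^alg|_{(l·Δ_Θ)}`" -/
  sAlg_eq_closure : sAlg = Subgroup.closure (Set.range fun p : R.lZ × W.DeltaYell => commutator p.1 p.2)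

/-- **IUTchII:Rmk1.1.1(iii)**, last sentence (p. 23): "The mono-theta-theoretic cyclotomic rigidity isomorphism
of Definition 1.1, (ii), is then reconstructed [cf. [EtTh], Corollary 2.19, (i)] by forming the
difference of the two sections `s^Θ(M)|_{(l·Δ_Θ)}`, `s^alg(M)|_{(l·Δ_Θ)}`": for every `a ∈ (l·Δ_Θ)(M)`
with lifts `t ∈ s^Θ`, `s ∈ s^alg` over `a`, the element `t·s⁻¹` lies in (the image of) `Π_μ(M)` and is
the value of the rigidity isomorphism on `a mod N`. Named `Prop` relating a `CyclotomicRigidity` to the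
sections. [claim: Mochizuki2012, status: disputed] (IUTchII §1 Rmk 1.1.1 (iii), kurims p.23) -/
def rigidity_is_difference {R : Reconstruction M} {T : ThetaQuotientData R} {W : CoreTower R}
    (Sec : TwoSections T W) (C : CyclotomicRigidity R) : Prop :=
  ∀ (a : R.intCyc.carrier) (t s : T.envAtTheta.carrier), t ∈ Sec.sTheta → s ∈ Sec.sAlg →
    T.proj t = a → T.proj s = a →
      ∃ m : R.extCyc, (C.iso (QuotientGroup.mk a) = m) ∧
        (QuotientGroup.mk (s := T.envAtTheta.bot.subgroupOf T.envAtTheta.top)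
            ⟨(m : M.Pi), by
              change (m : M.Pi) ∈ R.intCyc.top.comap R.projY
              simp [Subgroup.mem_comap, (R.projY.mem_ker).mp m.2, one_mem]⟩ = t * s⁻¹)

/-! ## Remark 1.1.1 (iv): the `𝔽_l^{⋊±}`-symmetry -/

/-- **IUTchII:Rmk1.1.1(iv)** (pp. 23–24): "the natural conjugation action of `Π_Y(M)` on `Π_M|_{(l·Δ_Θ)(M)}`
factors through the natural surjection `Π_Y(M) ↠ G(M)`. In particular, by applying the natural
surjection `Π_C(M) ↠ G(M)`, one may regard `Π_M|_{(l·Δ_Θ)(M)}` as being equipped with a "naively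
defined" action by `Π_C(M)` … [which] necessarily coincides with the natural conjugation action arising
from the model embedding `Π_M ↪ Π_μ(M) ⋊ Π_C(M)` [and] with the action of `G(M)` via the cyclotomic
character `G(M) → Ẑ^×` … one may regard the commutator map of (iii) as a map
`[-,-] : (Δ_X(M)/Δ_Y(M)) × Δ^ell_Y(M) → Π_M|_{(l·Δ_Θ)(M)}` for which both the domain and the codomain
are equipped with natural actions by `Π_C(M)`. Now one verifies easily that this commutator map is
equivariant with respect to these natural actions by `Π_C(M)`, and, moreover, that the various
subgroups of `Π_M|_{(l·Δ_Θ)(M)}` constructed in (iii) are stabilized by the natural action by `Π_C(M)`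
… hence, in particular, by the natural action by `(Π_C(M) ⊇) Δ_C(M) ↠ Δ_C(M)/Δ_X(M) ≅ 𝔽_l^{⋊±}`."
DATA + printed properties. [claim: Mochizuki2012, status: disputed] (IUTchII §1 Rmk 1.1.1 (iv), kurims pp.23-24) -/
structure FlSymmetry {R : Reconstruction M} {T : ThetaQuotientData R} {W : CoreTower R}
    (Sec : TwoSections T W) : Type u where
  /-- the "naively defined" action of `Π_C(M)` on `Π_M|_{(l·Δ_Θ)(M)}` -/
  act : W.PiC →* MulAut T.envAtTheta.carrier
  /-- it factors through `Π_C(M) ↠ G(M)` -/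
  act_factors : W.DeltaC ≤ act.ker
  /-- "the abelian profinite group `Π_μ(M) ⋊ (l·Δ_Θ)(M)`" (`= Π_M|_{(l·Δ_Θ)(M)}`): it is commutative, so that
  the `G(M)`-action "via the cyclotomic character `G(M) → Ẑ^×`" ("`Ẑ^×` acts tautologically on any abelian
  profinite group") makes sense -/
  abelian : ∀ x y : T.envAtTheta.carrier, x * y = y * x
  /-- the natural `Π_C(M)`-actions on `Δ_X/Δ_Y` and on `Δ^ell_Y` (via the natural isomorphisms with the
  `Π_C`-stable subquotients `Δ_X/Δ_Y ≅ Δ_X(M)/Δ_Y(M)`, `Δ^ell_Y ≅ Δ^ell_Y` of the unprimed tower) -/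
  actlZ : W.PiC →* MulAut R.lZ
  actEll : W.PiC →* MulAut W.DeltaYell
  /-- "this commutator map is equivariant with respect to these natural actions by `Π_C(M)`" -/
  commutator_equivariant : ∀ (c : W.PiC) (a : R.lZ) (y : W.DeltaYell),
    Sec.commutator (actlZ c a) (actEll c y) = act c (Sec.commutator a y)
  /-- "the various subgroups … constructed in (iii) are stabilized by the natural action by `Π_C(M)`" -/
  sTheta_stable : ∀ c : W.PiC, Sec.sTheta.map (act c).toMonoidHom = Sec.sTheta
  sAlg_stable : ∀ c : W.PiC, Sec.sAlg.map (act c).toMonoidHom = Sec.sAlg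
  /-- `Δ_C(M)/Δ_X(M) ≅ 𝔽_l^{⋊±}` ([IUTchI] Def. 6.1 (v)): `Δ_X` is normal in `Δ_C` with that quotient -/
  deltaX_normal : (W.DeltaXplain.subgroupOf W.DeltaC).Normal
  quot_iso_Fl : Nonempty (W.DeltaC ⧸ W.DeltaXplain.subgroupOf W.DeltaC ≃* Literature.IUT.HodgeTheaters.FlPM S.l)

/-- **IUTchII:Rmk1.1.1(i)**: for every mono-theta environment `M` and every output `R`
of the Def. 1.1 (i) algorithms there exist (group-theoretically, functorially in `M`) the core tower,
the theta-quotient data, the two sections with their commutator map, and the `𝔽_l^{⋊±}`-symmetry data,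
and the Def. 1.1 (ii) isomorphism is the difference of the two sections ([EtTh] Cor. 2.18, 2.19, Prop.
2.14). PREDICATE on the Def. 1.1 output `(R, C)` (asserted by the text for the genuine output; stating it for
all data of an axiom-free interface would be refutable on junk data — review of p403770).
[claim: Mochizuki2012, status: disputed] (IUTchII §1 Rmk 1.1.1, kurims pp.21-24) -/
def Rmk111_structures {M : MonoThetaEnv S} (R : Reconstruction M) (C : CyclotomicRigidity R) : Prop :=
  ∃ (T : ThetaQuotientData R) (W : CoreTower R) (Sec : TwoSections T W),
    rigidity_is_difference Sec C ∧ Nonempty (FlSymmetry Sec)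

/-- **IUTchII:Rmk1.1.1(iv)**, model-embedding clause (p. 24): "up to composition with automorphisms of `Π_M`
that differ from the identity automorphism by a twisted homomorphism
`Π_M ↠ Π_Y(M) ↠ Π^ell_Y(M) → Π_μ(M)` … — i.e., automorphisms that have no effect on the construction of
the commutator map —, the model embedding `Π_M ↪ Π_μ(M) ⋊ Π_C(M)` may be reconstructed algorithmically
from the mono-theta environment `M`." Typed as: there is an injective homomorphism of `Π_M` into a
semidirect product `Π_μ(M) ⋊ Π_C(M)` (for the recorded action of `Π_C` on `Π_μ`), compatible with the
inclusion of `Π_μ(M)` and with `Π_M ↠ Π_Y(M) ⊆ Π_C(M)`, unique up to the stated automorphisms (the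
uniqueness clause is recorded in prose). PREDICATE on the data `(R, W, φ)`.
[claim: Mochizuki2012, status: disputed] (IUTchII §1 Rmk 1.1.1 (iv), kurims p.24) -/
def Rmk111_iv_modelEmbedding {M : MonoThetaEnv S} (R : Reconstruction M) (W : CoreTower R)
    (φ : W.PiC →* MulAut R.extCyc) : Prop :=
  (∀ x : R.PiX, φ (W.isoXbarbar x : W.PiC) = R.extAct x) →
    ∃ ι : M.Pi →* R.extCyc ⋊[φ] W.PiC, Function.Injective ι ∧
      (∀ m : R.extCyc, ι m = SemidirectProduct.inl m) ∧
      (∀ g : M.Pi, (ι g).right = (W.isoXbarbar (R.inclY (R.projY g)) : W.PiC))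

end Literature.IUT.HodgeArakelov
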